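import Summits.AtomisticToContinuum.HydrodynamicLimit.Theses.JParityClosure
import Summits.AtomisticToContinuum.HydrodynamicLimit.Theorems.JParityClosureParityBandClosureSurprisalTestContinuityA
import Mathlib.MeasureTheory.Measure.ProbabilityMeasure
import Mathlib.MeasureTheory.Measure.FiniteMeasure
import HarnessLib

/-!
# Joint weak continuity of the Metropolis-odd test functional (stub `stub_surprisalTestContinuity`)

Waypoint `SurprisalTestContinuity` of the line `transfer-weighted-parity-chain` (skeleton v3) of the crux
`JParityClosure.ParityBandClosure` (stmt-AtomisticToContinuum-17608).

Along `ν_n → ν` weakly (probability laws on `V3 = ℝ³`) and `κ_n → κ` weakly (finite collision records on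
`Q = (ℝ³ × ℝ³) × S²` with second moments `≤ M`), for every bandwidth `ϑ ∈ (0,1)` and every bounded continuous
mark `Ψ` on `Q`,
`∫ Ψ · min(1, e^{-F^{ν_n}_ϑ}) dκ_n → ∫ Ψ · min(1, e^{-F^ν_ϑ}) dκ`,
where `h^μ_ϑ(v) = ∫ localMaxwellian 1 ϑ² v v' dμ(v')` is the Gaussian KDE of `μ` and
`F^μ_ϑ(q) = log h(q.1.1) + log h(q.1.2) - log h((collide q.2 q.1).1) - log h((collide q.2 q.1).2)` its surprisal jump.

Proof sketch (the analytic input is the helper file `…SurprisalTestContinuityA`).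
* The KDEs `h^{ν_n}_ϑ` are equi-Lipschitz and converge pointwise, hence uniformly on compacts (Arzelà–Ascoli); the
  continuous positive limit is bounded below on compacts, so `log h^{ν_n}_ϑ → log h^ν_ϑ` uniformly on the energy
  sub-level sets (`tendstoUniformlyOn_log_integral_localMaxwellian`) and, by energy conservation of `collide`,
  `F^{ν_n}_ϑ → F^ν_ϑ` uniformly on `{‖q.1.1‖² + ‖q.1.2‖² ≤ R}` (`tendstoUniformlyOn_jump`).
* `x ↦ min(1, e^{-x})` is `1`-Lipschitz and the integrands `g_n, g` are bounded by `C = sup |Ψ|`, whence the pointwise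
  bound `|g_n - g| ≤ ε/(4B) + (2C/R) · (‖q.1.1‖² + ‖q.1.2‖²)` (Markov tail term); integrating against `κ_n` (second
  moments `≤ M`, masses convergent hence eventually `≤ B`) and adding the weak convergence `∫ g dκ_n → ∫ g dκ` of the
  records against the bounded continuous limit integrand gives the `ε`-estimate.

References: P. Billingsley, *Convergence of Probability Measures* (1999), §2 (weak convergence against bounded
continuous test functions).
-/

noncomputable section

namespace Summit.AtomisticToContinuum.HydrodynamicLimit.Theorems.ParityBandClosureSurprisalContinuity

open scoped BigOperators Topology Classical MeasureTheory ENNReal InnerProductSpace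
open Filter Set MeasureTheory
open Literature.MathematicalPhysics.KineticTheory Literature.Analysis.FluidPDE
open Summit.AtomisticToContinuum.HydrodynamicLimit.Theorems.ParityRigidity (integral_localMaxwellian_pos)

/-! ## The waypoint -/

/-- **Joint weak continuity of the Metropolis-odd test functional at fixed bandwidth** (waypoint
`SurprisalTestContinuity` of skeleton v3 of the line `transfer-weighted-parity-chain`, VERBATIM).  Along
`ν_n → ν` weakly (probability laws on `ℝ³` with second moments `≤ M`) and `κ_n → κ` weakly (finite records on `Q` with
second moments `≤ M`), for every `ϑ ∈ (0,1)` and every bounded continuous `Ψ`: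
`∫ Ψ min(1, e^{−F^{ν_n}_ϑ}) dκ_n → ∫ Ψ min(1, e^{−F^ν_ϑ}) dκ`. -/
def SurprisalTestContinuity : Prop :=
  ∀ (M : ℝ) (νs : ℕ → ProbabilityMeasure V3) (ν : ProbabilityMeasure V3)
    (κs : ℕ → FiniteMeasure ((V3 × V3) × Metric.sphere (0 : V3) 1))
    (κ : FiniteMeasure ((V3 × V3) × Metric.sphere (0 : V3) 1)),
    Tendsto νs atTop (𝓝 ν) → Tendsto κs atTop (𝓝 κ) →
    (∀ n, Integrable (fun v : V3 => ‖v‖ ^ 2) (νs n : Measure V3) ∧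
      ∫ v, ‖v‖ ^ 2 ∂(νs n : Measure V3) ≤ M) →
    (∀ n, Integrable (fun q : (V3 × V3) × Metric.sphere (0 : V3) 1 => ‖q.1.1‖ ^ 2 + ‖q.1.2‖ ^ 2)
        (κs n : Measure ((V3 × V3) × Metric.sphere (0 : V3) 1)) ∧
      ∫ q, (‖q.1.1‖ ^ 2 + ‖q.1.2‖ ^ 2) ∂(κs n : Measure ((V3 × V3) × Metric.sphere (0 : V3) 1)) ≤ M) →
    ∀ ϑ : ℝ, 0 < ϑ → ϑ < 1 → ∀ Ψ : (V3 × V3) × Metric.sphere (0 : V3) 1 → ℝ, Continuous Ψ →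
      (∃ C : ℝ, ∀ q, |Ψ q| ≤ C) →
      let h : Measure V3 → V3 → ℝ := fun μ v => ∫ v', localMaxwellian 1 (ϑ ^ 2) v v' ∂μ
      let F : Measure V3 → (V3 × V3) × Metric.sphere (0 : V3) 1 → ℝ := fun μ q =>
        Real.log (h μ q.1.1) + Real.log (h μ q.1.2) -
          Real.log (h μ (collide q.2 q.1).1) - Real.log (h μ (collide q.2 q.1).2)
      Tendsto (fun n => ∫ q, Ψ q * min 1 (Real.exp (-(F (νs n : Measure V3) q)))
          ∂(κs n : Measure ((V3 × V3) × Metric.sphere (0 : V3) 1))) atTop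
        (𝓝 (∫ q, Ψ q * min 1 (Real.exp (-(F (ν : Measure V3) q)))
          ∂(κ : Measure ((V3 × V3) × Metric.sphere (0 : V3) 1))))


/-- **STUB `stub_surprisalTestContinuity`** (line `transfer-weighted-parity-chain`, crux `ParityBandClosure`,
stmt-AtomisticToContinuum-17608): the Metropolis-odd test functional `(ν, κ) ↦ ∫ Ψ min(1, e^{-F^ν_ϑ}) dκ` is jointly
continuous along weakly convergent sequences with bounded second moments.  Locally uniform convergence of the
surprisal jumps (`tendstoUniformlyOn_log_integral_localMaxwellian`, `tendstoUniformlyOn_jump`), the `1`-Lipschitz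
Metropolis factor, the Markov tail bound from the second moments of `κ_n`, convergence of the masses and weak
convergence of `κ_n` against the bounded continuous limit integrand. -/
theorem stub_surprisalTestContinuity : SurprisalTestContinuity := by
  intro M νs ν κs κ hν hκ hνb hκb ϑ hϑ0 _hϑ1 Ψ hΨc hΨb h F
  obtain ⟨C', hC'⟩ := hΨb
  have hC : ∀ q, |Ψ q| ≤ max C' 0 := fun q => (hC' q).trans (le_max_left _ _)
  have hC0 : 0 ≤ max C' 0 := le_max_right _ _
  generalize max C' 0 = C at hC hC0
  have hM0 : 0 ≤ M := (integral_nonneg fun v => by positivity).trans (hνb 0).2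
  -- the Metropolis-weighted marks `g^μ = Ψ · min(1, e^{-F^μ})`: continuous, bounded by `C`, integrable
  set g : Measure V3 → (V3 × V3) × Metric.sphere (0 : V3) 1 → ℝ := fun μ q => Ψ q * min 1 (Real.exp (-(F μ q)))
  have hFc : ∀ (μ : Measure V3) [IsProbabilityMeasure μ], Continuous (F μ) := fun μ _ =>
    continuous_jump ((continuous_integral_localMaxwellian μ hϑ0).log fun v =>
      (integral_localMaxwellian_pos μ hϑ0.ne' v).ne')
  have hgc : ∀ (μ : Measure V3) [IsProbabilityMeasure μ], Continuous (g μ) := fun μ _ =>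
    hΨc.mul (continuous_const.min (Real.continuous_exp.comp (hFc μ).neg))
  have hgb : ∀ (μ : Measure V3) (q : (V3 × V3) × Metric.sphere (0 : V3) 1), ‖g μ q‖ ≤ C := fun μ q => by
    rw [Real.norm_eq_abs]
    exact abs_mul_min_one_exp_neg_le (hC q) _
  have hgi : ∀ (μ : Measure V3) [IsProbabilityMeasure μ] (n : ℕ),
      Integrable (g μ) (κs n : Measure ((V3 × V3) × Metric.sphere (0 : V3) 1)) := fun μ _ n =>
    Integrable.of_bound (hgc μ).aestronglyMeasurable C (ae_of_all _ (hgb μ))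
  show Tendsto (fun n => ∫ q, g (νs n) q ∂(κs n : Measure ((V3 × V3) × Metric.sphere (0 : V3) 1))) atTop
    (𝓝 (∫ q, g ν q ∂(κ : Measure ((V3 × V3) × Metric.sphere (0 : V3) 1))))
  -- weak convergence of the records against the (bounded continuous) limit integrand
  have hlim : Tendsto (fun n => ∫ q, g ν q ∂(κs n : Measure ((V3 × V3) × Metric.sphere (0 : V3) 1))) atTop
      (𝓝 (∫ q, g ν q ∂(κ : Measure ((V3 × V3) × Metric.sphere (0 : V3) 1)))) :=
    FiniteMeasure.tendsto_iff_forall_integral_tendsto.1 hκ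
      (BoundedContinuousFunction.ofNormedAddCommGroup (g ν) (hgc ν) C (hgb ν))
  -- the masses converge, hence are eventually bounded
  have hmass : Tendsto (fun n => (κs n : Measure ((V3 × V3) × Metric.sphere (0 : V3) 1)).real univ) atTop
      (𝓝 ((κ : Measure ((V3 × V3) × Metric.sphere (0 : V3) 1)).real univ)) := by
    have := FiniteMeasure.tendsto_iff_forall_integral_tendsto.1 hκ
      (BoundedContinuousFunction.const ((V3 × V3) × Metric.sphere (0 : V3) 1) (1 : ℝ))
    simpa only [BoundedContinuousFunction.const_apply, integral_const, smul_eq_mul, mul_one] using this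
  obtain ⟨B, hB0, hmassB⟩ : ∃ B : ℝ, 0 < B ∧
      ∀ᶠ n in atTop, (κs n : Measure ((V3 × V3) × Metric.sphere (0 : V3) 1)).real univ ≤ B :=
    ⟨(κ : Measure ((V3 × V3) × Metric.sphere (0 : V3) 1)).real univ + 1, by positivity,
      hmass.eventually_le_const (lt_add_one _)⟩
  -- the `ε`-argument
  refine Metric.tendsto_nhds.2 fun ε hε => ?_
  obtain ⟨R, hR0, hRM⟩ : ∃ R : ℝ, 0 < R ∧ 2 * C * M / R ≤ ε / 4 := by
    refine ⟨8 * C * M / ε + 1, by positivity, ?_⟩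
    rw [div_le_iff₀ (by positivity)]
    have : ε / 4 * (8 * C * M / ε + 1) = 2 * C * M + ε / 4 := by field_simp; ring
    rw [this]
    linarith
  -- locally uniform convergence of the surprisal jumps, hence of the marks, on `{energy ≤ R}`
  have hunifF : TendstoUniformlyOn (fun n => F (νs n)) (F ν) atTop
      {q : (V3 × V3) × Metric.sphere (0 : V3) 1 | ‖q.1.1‖ ^ 2 + ‖q.1.2‖ ^ 2 ≤ R} :=
    tendstoUniformlyOn_jump (tendstoUniformlyOn_log_integral_localMaxwellian νs ν hν ϑ hϑ0 R)
  have hunifg : TendstoUniformlyOn (fun n => g (νs n)) (g ν) atTop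
      {q : (V3 × V3) × Metric.sphere (0 : V3) 1 | ‖q.1.1‖ ^ 2 + ‖q.1.2‖ ^ 2 ≤ R} :=
    tendstoUniformlyOn_mul_min_one_exp_neg hC hunifF
  have hunif := Metric.tendstoUniformlyOn_iff.1 hunifg (ε / (4 * B)) (by positivity)
  have hlim' := Metric.tendsto_nhds.1 hlim (ε / 4) (by positivity)
  filter_upwards [hmassB, hunif, hlim'] with n hmn hun hln
  -- pointwise bound with a Markov tail term
  have hpt : ∀ q : (V3 × V3) × Metric.sphere (0 : V3) 1,
      |g (νs n) q - g ν q| ≤ ε / (4 * B) + 2 * C / R * (‖q.1.1‖ ^ 2 + ‖q.1.2‖ ^ 2) := by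
    intro q
    have h3 : (0 : ℝ) ≤ 2 * C / R * (‖q.1.1‖ ^ 2 + ‖q.1.2‖ ^ 2) := by positivity
    by_cases hq : ‖q.1.1‖ ^ 2 + ‖q.1.2‖ ^ 2 ≤ R
    · have h1 : |g (νs n) q - g ν q| < ε / (4 * B) := by
        have := hun q hq
        rwa [Real.dist_eq, abs_sub_comm] at this
      linarith
    · rw [not_le] at hq
      have h1 : |g (νs n) q - g ν q| ≤ 2 * C := by
        have ha : |g (νs n) q| ≤ C := abs_mul_min_one_exp_neg_le (hC q) _
        have hb : |g ν q| ≤ C := abs_mul_min_one_exp_neg_le (hC q) _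
        linarith [abs_sub (g (νs n) q) (g ν q)]
      have h2 : 2 * C ≤ 2 * C / R * (‖q.1.1‖ ^ 2 + ‖q.1.2‖ ^ 2) := by
        calc 2 * C = 2 * C / R * R := by rw [div_mul_cancel₀ _ hR0.ne']
          _ ≤ 2 * C / R * (‖q.1.1‖ ^ 2 + ‖q.1.2‖ ^ 2) := by gcongr
      have h4 : 0 ≤ ε / (4 * B) := by positivity
      linarith
  -- integrate the pointwise bound against `κ_n`
  have hE := (hκb n).1
  have hEM := (hκb n).2
  have hI : |(∫ q, g (νs n) q ∂(κs n : Measure ((V3 × V3) × Metric.sphere (0 : V3) 1))) -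
      ∫ q, g ν q ∂(κs n : Measure ((V3 × V3) × Metric.sphere (0 : V3) 1))| ≤ ε / 4 + ε / 4 := by
    rw [← integral_sub (hgi _ n) (hgi _ n)]
    calc |∫ q, (g (νs n) q - g ν q) ∂(κs n : Measure ((V3 × V3) × Metric.sphere (0 : V3) 1))|
        ≤ ∫ q, |g (νs n) q - g ν q| ∂(κs n : Measure ((V3 × V3) × Metric.sphere (0 : V3) 1)) :=
          abs_integral_le_integral_abs
      _ ≤ ∫ q, (ε / (4 * B) + 2 * C / R * (‖q.1.1‖ ^ 2 + ‖q.1.2‖ ^ 2))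
            ∂(κs n : Measure ((V3 × V3) × Metric.sphere (0 : V3) 1)) :=
          integral_mono ((hgi _ n).sub (hgi _ n)).abs ((integrable_const _).add (hE.const_mul _)) hpt
      _ = (κs n : Measure ((V3 × V3) × Metric.sphere (0 : V3) 1)).real univ * (ε / (4 * B)) +
            2 * C / R * ∫ q, (‖q.1.1‖ ^ 2 + ‖q.1.2‖ ^ 2)
              ∂(κs n : Measure ((V3 × V3) × Metric.sphere (0 : V3) 1)) := by
          rw [integral_add (integrable_const _) (hE.const_mul _), integral_const, integral_const_mul,
            smul_eq_mul]
      _ ≤ B * (ε / (4 * B)) + 2 * C / R * M := by gcongr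
      _ = ε / 4 + 2 * C * M / R := by field_simp
      _ ≤ ε / 4 + ε / 4 := by linarith
  have hJ : |(∫ q, g ν q ∂(κs n : Measure ((V3 × V3) × Metric.sphere (0 : V3) 1))) -
      ∫ q, g ν q ∂(κ : Measure ((V3 × V3) × Metric.sphere (0 : V3) 1))| < ε / 4 := by
    rwa [Real.dist_eq] at hln
  rw [Real.dist_eq]
  calc |(∫ q, g (νs n) q ∂(κs n : Measure ((V3 × V3) × Metric.sphere (0 : V3) 1))) -
        ∫ q, g ν q ∂(κ : Measure ((V3 × V3) × Metric.sphere (0 : V3) 1))|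
      ≤ |(∫ q, g (νs n) q ∂(κs n : Measure ((V3 × V3) × Metric.sphere (0 : V3) 1))) -
            ∫ q, g ν q ∂(κs n : Measure ((V3 × V3) × Metric.sphere (0 : V3) 1))| +
          |(∫ q, g ν q ∂(κs n : Measure ((V3 × V3) × Metric.sphere (0 : V3) 1))) -
            ∫ q, g ν q ∂(κ : Measure ((V3 × V3) × Metric.sphere (0 : V3) 1))| :=
        abs_sub_le _ _ _
    _ < ε := by linarith

end Summit.AtomisticToContinuum.HydrodynamicLimit.Theorems.ParityBandClosureSurprisalContinuity
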